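import Literature.NumberTheory.LFunctions.Zhang2022.EllRegimeStatements
import HarnessLib

/-!
# Zhang (2022) in the `ℓ`-regime: the dipole parameter `λ(χ) = L″(1,χ)/(2L′(1,χ)log D)`, the `λ`-box row,
# and the B-ell dictionary rows at the TRUE `λ` (cell `landau-siegel`, family B-ell; typing request
# D-ELL-1-K0 §6.3 / B-ell EDLIST v1.13 «`EllLambdaBox`»)

Topic `Literature/NumberTheory/LFunctions/Zhang2022` (Landau–Siegel audit tree; verdict-neutral).
Y. Zhang, *Discrete mean estimates and the Landau–Siegel zero*, arXiv:2211.02515v1 [Zhang2022LandauSiegel] —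
an unrefereed manuscript under adjudication. **WHAT THIS IS NOT: not a claim about Theorems 1–2 of
arXiv:2211.02515, about Landau–Siegel zeros, or about Parity. Every `def … : Prop` below is a NAMED STATEMENT
(a registry row / derivation target of the cell), asserted by no one; the `theorem`s are bookkeeping
implications between the rows.**

WHY THIS FILE.  The first-order dictionary rows of `EllRegimeStatements` (E-022 `EllDictFirstOrderLam`,
`EllDictFirstOrderProfile`, Part 8's `EllCSDictLam`) carry the dipole correction as `G₀ + λ·G₁` for SOME
`λ = λ(D,χ)` with `|λ| ≤ Λ` (ls-theory rulings Q3 16:51:20Z / 17:10:30Z (2)(e): `λ(χ) = (H′/H)(1,χ)/log D`,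
`H(s) = L(s,χ)/(s − β₁)`; the cell's D-ELL-1-K0.md §6 books it as `λ = L″(1,χ)/(2L′(1,χ)log D)`).  That
existential mixes two things of different status: (a) the DICTIONARY at the true `λ(χ)` (a derivation about the
manuscript's discrete means: Lemmas 8.2–8.4's residues re-read at `P = D^A`, where the ratio `L″/L′(1,χ)`
appears through the double pole's Laurent data, §4 Lemma 4.7 / (4.10) and §5 Lemma 5.4), and (b) the `λ`-BOX
(how large `λ(χ)` can be under (A): Hadamard factorisation + Deuring–Heilbronn repulsion + zero counting —
D-ELL-1-K0 §6.1, «theorem-shape under (A)», inputs: explicit DH [tree: `BGTZ2025.corollary11`, registry E-008]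
and explicit `N(T,χ)` [Bennett–Martin–O'Bryant–Rechnitzer, *Counting zeros of Dirichlet L-functions*,
Math. Comp. 90 (2021), arXiv:2005.02989 — not in the tree]; and the HEURISTIC one-sided model bound
`λ ≤ −1.7171/log D` of §6.2).  This file separates them:

* `lambdaDipole χ := Re L″(1,χ)/(2·Re L′(1,χ)·log D)` (real parts: for a real character the derivatives at
  `1` are real);
* rows `EllLambdaBox η C₀` (under (A), eventually: `−½ − η ≤ λ(χ) ≤ C₀/log D`) and `EllLambdaOneSided c`
  (`λ(χ) ≤ −c/log D`; the §6.2 model identification names `c = 1.7171`, HEURISTIC);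
* the dictionary rows AT THE TRUE `λ`: `EllDictFirstOrderTrue`, `EllDictFirstOrderProfileTrue`,
  `EllCSDictTrue` (the bodies `DictAt` / profile / `CSProbeDictAt` of `EllRegimeStatements` with
  `lam := lambdaDipole χ`, no existential);
* PROVED bridges: `abs_lambdaDipole_le_of_box` (the box puts `|λ(χ)| ≤ Λ` once `½ + η ≤ Λ` and
  `log D ≥ C₀/Λ`), `ellDictFirstOrderLam_of_true`, `ellDictFirstOrderProfile_of_true`, `ellCSDictLam_of_true`
  (TRUE-`λ` row + `EllLambdaBox η C₀` + `½ + η ≤ Λ` ⇒ the `Λ`-box rows consumed by the PROVED endgames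
  `theorem1_of_ellDictProfile` / `theorem1_of_ellCSDict`).

Deliberately NOT here: any proof of `EllLambdaBox` (its inputs are named above; the row's status is
«derivation, sketched, unreviewed»), any numerical value of record, and any claim that a row holds.

## References
* Y. Zhang, arXiv:2211.02515v1 (2022): §4 Lemma 4.7, (4.10); §5 Lemma 5.4, Lemma 5.5, Lemma 5.7; §8 Lemmas
  8.2–8.4, (8.23); §2 (2.13), (2.32). [cite: Zhang2022LandauSiegel, §4 Lemma 4.7, §5 Lemmas 5.4–5.7, §8 Lemmas 8.2–8.4]

«The programme SEARCHES and TYPES; no claim about Landau–Siegel zeros, Theorems 1–2 of arXiv:2211.02515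
or a repaired Margin232 until a kernel theorem says so.»
-/

noncomputable section

open Complex Real

namespace Literature.NumberTheory.LFunctions.Zhang2022

namespace EllRegime

open EllScales Repair Skeleton

/-! ## The dipole parameter `λ(χ)` and its box -/

section Lambda

variable {D : ℕ} [NeZero D]

/-- **The dipole parameter `λ(χ) := L″(1,χ)/(2L′(1,χ)·log D)`** (real parts; for a real character `χ` the
values `L′(1,χ)`, `L″(1,χ)` are real) — the `O(1)` adversarial datum of dict-1's first-order term
`G₀ + λ·G₁` (ls-theory Q3/(2)(e); D-ELL-1-K0 §6), set by the low zeros of `L(s,χ)` through the Laurent data of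
the double pole in Lemmas 8.2–8.4 / Lemma 5.4. [cite: Zhang2022LandauSiegel, §5 Lemma 5.4, Lemma 5.7; §8 Lemmas 8.2–8.4] -/
def lambdaDipole (χ : DirichletCharacter ℂ D) : ℝ :=
  (iteratedDeriv 2 χ.LFunction 1).re / (2 * (deriv χ.LFunction 1).re * Real.log D)

/-- **Row «EllLambdaBox (η, C₀)»** (typing request D-ELL-1-K0 §6.3; B-ell EDLIST v1.13): under (A), for every
real primitive `χ` to every large modulus `D`, `−½ − η ≤ λ(χ) ≤ C₀/log D`.  D-ELL-1-K0 §6.1 sketches it as a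
theorem-shape consequence of the Hadamard factorisation of `H(s) = L(s,χ)/(s − β₁)`, Deuring–Heilbronn repulsion
in explicit form (tree: `BGTZ2025.corollary11`, registry E-008) and explicit zero counting `N(T,χ)`
(Bennett–Martin–O'Bryant–Rechnitzer 2021, not in the tree): `0 < Σ_{ρ≠β₁} Re 1/(1−ρ) = O(1)` under (A), whence
`λ·log D = Σ_{ρ≠β₁} Re 1/(1−ρ) − ½log(D/π) − ½ψ((1+𝔞)/2) + O(1−β₁)`.  Status: derivation (sketched, unreviewed).
A DEFINITION; asserted for no `(η, C₀)`. [cite: Zhang2022LandauSiegel, §5 Lemma 5.5 (Deuring–Heilbronn), Lemma 5.7; §4 (4.10)] -/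
def EllLambdaBox (η C₀ : ℝ) : Prop :=
  ForAllLarge fun D _ χ => AssumptionA D χ →
    -(1 / 2 : ℝ) - η ≤ lambdaDipole χ ∧ lambdaDipole χ ≤ C₀ / Real.log D

/-- **Row «EllLambdaOneSided (c)»**: under (A), eventually `λ(χ) ≤ −c/log D` — the ONE-SIDED box of
D-ELL-1-K0 §6.2 (model identification under (A): `λ·log D = 2ζ′(2)/ζ(2) − γ − Σ_{p∣D} log p/(p+1) −
2Σ_{χ(p)=1} p log p/(p²−1) + o(1) ≤ −1.7171 + o(1)`, HEURISTIC), which makes the robust test read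
`sup_{λ ∈ [−½−η, −c/log D]}`.  A DEFINITION; asserted for no `c`. [cite: Zhang2022LandauSiegel, §5 Lemma 5.7; §4 (4.10)] -/
def EllLambdaOneSided (c : ℝ) : Prop :=
  ForAllLarge fun D _ χ => AssumptionA D χ → lambdaDipole χ ≤ -c / Real.log D

/-- The two-sided box puts `λ(χ)` in the symmetric `Λ`-box of the Part 3/8 rows: if `−½ − η ≤ λ ≤ C₀/log D`,
`½ + η ≤ Λ` and `log D ≥ C₀/Λ > 0`… precisely: `0 < Λ`, `½ + η ≤ Λ`, `C₀ ≤ Λ·log D` ⇒ `|λ| ≤ Λ`.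
[cite: Zhang2022LandauSiegel, §5 Lemma 5.7] -/
theorem abs_le_of_box {lam η C₀ Λ L : ℝ} (hL : 0 < L) (hlo : -(1 / 2 : ℝ) - η ≤ lam) (hhi : lam ≤ C₀ / L)
    (hΛ : 1 / 2 + η ≤ Λ) (hC : C₀ ≤ Λ * L) : |lam| ≤ Λ := by
  rw [abs_le]
  refine ⟨by linarith, hhi.trans ?_⟩
  rw [div_le_iff₀ hL]
  exact hC

/-- **From the box row to `|λ(χ)| ≤ Λ` eventually**: `EllLambdaBox η C₀` and `½ + η ≤ Λ`, `0 < Λ` give, under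
(A), `|λ(χ)| ≤ Λ` for every real primitive `χ` to every modulus `D ≥ exp(C₀/Λ)` (and `≥ 2`).
[cite: Zhang2022LandauSiegel, §5 Lemma 5.5, Lemma 5.7] -/
theorem abs_lambdaDipole_le_of_box {η C₀ Λ : ℝ} (hbox : EllLambdaBox η C₀) (hΛ : 1 / 2 + η ≤ Λ)
    (hΛ0 : 0 < Λ) :
    ForAllLarge fun D _ χ => AssumptionA D χ → |lambdaDipole χ| ≤ Λ := by
  have hev := hbox.and (ForAllLarge.of_le (S := fun D _ _ => max ⌈Real.exp (C₀ / Λ)⌉₊ 2 ≤ D)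
    (max ⌈Real.exp (C₀ / Λ)⌉₊ 2) fun D _ χ hD _ _ => hD)
  refine hev.mono fun D _ χ _ _ hall hA => ?_
  obtain ⟨hb, hD⟩ := hall
  obtain ⟨hlo, hhi⟩ := hb hA
  have hD2 : (2 : ℕ) ≤ D := le_trans (le_max_right _ _) hD
  have hD1 : (1 : ℝ) < D := by exact_mod_cast lt_of_lt_of_le one_lt_two hD2
  have hL : 0 < Real.log (D : ℝ) := Real.log_pos hD1
  have hexp : Real.exp (C₀ / Λ) ≤ (D : ℝ) :=
    le_trans (Nat.le_ceil _) (by exact_mod_cast le_trans (le_max_left _ _) hD)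
  have hC : C₀ ≤ Λ * Real.log (D : ℝ) := by
    have h1 : C₀ / Λ ≤ Real.log (D : ℝ) := by
      rw [← Real.log_exp (C₀ / Λ)]
      exact Real.log_le_log (Real.exp_pos _) hexp
    rwa [div_le_iff₀' hΛ0] at h1
  exact abs_le_of_box hL hlo hhi hΛ hC

end Lambda

/-! ## The dictionary rows at the TRUE `λ(χ)` and the PROVED bridges to the `Λ`-box rows -/

section TrueLambda

/-- **E-022 at the TRUE `λ`**: as `EllDictFirstOrderLam` but with `lam := λ(χ) = lambdaDipole χ` — no existential,
no box.  The derivation D-ell-1 is a statement of THIS form; the box is the separate row `EllLambdaBox`.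
A DEFINITION; asserted for no `(G₀, G₁, K)`. [cite: Zhang2022LandauSiegel, §8 (8.23), Lemmas 8.2–8.4; §4 Lemma 4.7, (4.10); §2 (2.13)] -/
def EllDictFirstOrderTrue (c' : ℝ) (Fam : (S : Scales) → Finset (Chr S)) (Adm : Theta → Prop)
    (G₀ G₁ : Theta → ℝ → ℝ × ℝ × ℝ) (K : Theta → ℝ → ℝ) (A₀ : ℝ) : Prop :=
  ∀ θ : Theta, Adm θ → ∀ A B : ℝ, A₀ ≤ A →
    ForAllLarge fun D _ χ => AssumptionA D χ →
      ∀ S : Scales, S.D = D → S.IsEllRegime A B →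
        DictAt χ c' S (Fam S) θ ((G₀ θ B).1 + lambdaDipole χ * (G₁ θ B).1)
          ((G₀ θ B).2.1 + lambdaDipole χ * (G₁ θ B).2.1) ((G₀ θ B).2.2 + lambdaDipole χ * (G₁ θ B).2.2)
          (K θ B) A

/-- **E-022 for one profile at the TRUE `λ`** (as `EllDictFirstOrderProfile`, `lam := lambdaDipole χ`).
A DEFINITION. [cite: Zhang2022LandauSiegel, §8 (8.23), (8.3); §2 (2.10), (2.23)] -/
def EllDictFirstOrderProfileTrue (c' : ℝ) (Fam : (S : Scales) → Finset (Chr S)) (g g' : ℝ → ℂ)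
    (G₀ G₁ K A₀ : ℝ) : Prop :=
  ∀ A : ℝ, A₀ ≤ A →
    ForAllLarge fun D _ χ => AssumptionA D χ →
      ∀ S : Scales, S.D = D → S.IsEllRegimeP A →
        |profileMean χ c' S (Fam S) g ⌈S.P⌉₊ -
            (mainTermFormEll S.ellP (rescale S.shrink g) (rescale' S.shrink g') +
              (G₀ + lambdaDipole χ * G₁) / A)| ≤ K / A ^ 2

/-- **The tie/CS dictionary at the TRUE `λ`** (as Part 8's `EllCSDictLam`, `lam := lambdaDipole χ`).
A DEFINITION. [cite: Zhang2022LandauSiegel, §2 (2.17), (2.32)–(2.33), Props. 2.4–2.6; §8 (8.23); §10 (10.17); §11 (11.1)] -/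
def EllCSDictTrue (c' : ℝ) (Fam : (S : Scales) → Finset (Chr S)) (Adm : Theta → Prop)
    (G₀ G₁ : Theta → ℝ → ℝ × ℝ × ℝ) (GJ₀ GJ₁ : Theta → ℝ → ℝ) (GX₀ GX₁ : Theta → ℝ → ℂ)
    (δf : Theta → ℝ → ℝ → ℝ) (K : Theta → ℝ → ℝ) (A₀ : ℝ) : Prop :=
  ∀ θ : Theta, Adm θ → ∀ A B : ℝ, A₀ ≤ A →
    ForAllLarge fun D _ χ => AssumptionA D χ →
      ∀ S : Scales, S.D = D → S.IsEllRegime A B →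
        DictAt χ c' S (Fam S) θ ((G₀ θ B).1 + lambdaDipole χ * (G₁ θ B).1)
            ((G₀ θ B).2.1 + lambdaDipole χ * (G₁ θ B).2.1)
            ((G₀ θ B).2.2 + lambdaDipole χ * (G₁ θ B).2.2) (K θ B) A ∧
          CSProbeDictAt χ c' S (Fam S) θ (GJ₀ θ B + lambdaDipole χ * GJ₁ θ B)
            (GX₀ θ B + lambdaDipole χ * GX₁ θ B) (δf θ B A) (K θ B) A

/-- **Bridge: TRUE-`λ` dictionary + `λ`-box ⇒ E-022's `Λ`-form.** [cite: Zhang2022LandauSiegel, §8 (8.23); §5 Lemma 5.7] -/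
theorem ellDictFirstOrderLam_of_true {c' : ℝ} {Fam : (S : Scales) → Finset (Chr S)} {Adm : Theta → Prop}
    {G₀ G₁ : Theta → ℝ → ℝ × ℝ × ℝ} {K : Theta → ℝ → ℝ} {A₀ η C₀ Λ : ℝ}
    (h : EllDictFirstOrderTrue c' Fam Adm G₀ G₁ K A₀) (hbox : EllLambdaBox η C₀) (hΛ : 1 / 2 + η ≤ Λ)
    (hΛ0 : 0 < Λ) : EllDictFirstOrderLam c' Fam Adm G₀ G₁ Λ K A₀ := by
  intro θ hθ A B hA
  refine ((h θ hθ A B hA).and (abs_lambdaDipole_le_of_box hbox hΛ hΛ0)).mono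
    fun D _ χ _ _ hall hAss => ?_
  exact ⟨lambdaDipole χ, hall.2 hAss, hall.1 hAss⟩

/-- **Bridge, one profile.** [cite: Zhang2022LandauSiegel, §8 (8.23); §5 Lemma 5.7] -/
theorem ellDictFirstOrderProfile_of_true {c' : ℝ} {Fam : (S : Scales) → Finset (Chr S)} {g g' : ℝ → ℂ}
    {G₀ G₁ K A₀ η C₀ Λ : ℝ} (h : EllDictFirstOrderProfileTrue c' Fam g g' G₀ G₁ K A₀)
    (hbox : EllLambdaBox η C₀) (hΛ : 1 / 2 + η ≤ Λ) (hΛ0 : 0 < Λ) :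
    EllDictFirstOrderProfile c' Fam g g' G₀ G₁ Λ K A₀ := by
  intro A hA
  refine ((h A hA).and (abs_lambdaDipole_le_of_box hbox hΛ hΛ0)).mono fun D _ χ _ _ hall hAss => ?_
  exact ⟨lambdaDipole χ, hall.2 hAss, hall.1 hAss⟩

/-- **Bridge, tie/CS sheet.** [cite: Zhang2022LandauSiegel, §2 (2.17), (2.32)–(2.33); §5 Lemma 5.7] -/
theorem ellCSDictLam_of_true {c' : ℝ} {Fam : (S : Scales) → Finset (Chr S)} {Adm : Theta → Prop}
    {G₀ G₁ : Theta → ℝ → ℝ × ℝ × ℝ} {GJ₀ GJ₁ : Theta → ℝ → ℝ} {GX₀ GX₁ : Theta → ℝ → ℂ}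
    {δf : Theta → ℝ → ℝ → ℝ} {K : Theta → ℝ → ℝ} {A₀ η C₀ Λ : ℝ}
    (h : EllCSDictTrue c' Fam Adm G₀ G₁ GJ₀ GJ₁ GX₀ GX₁ δf K A₀) (hbox : EllLambdaBox η C₀)
    (hΛ : 1 / 2 + η ≤ Λ) (hΛ0 : 0 < Λ) :
    EllCSDictLam c' Fam Adm G₀ G₁ GJ₀ GJ₁ GX₀ GX₁ Λ δf K A₀ := by
  intro θ hθ A B hA
  refine ((h θ hθ A B hA).and (abs_lambdaDipole_le_of_box hbox hΛ hΛ0)).mono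
    fun D _ χ _ _ hall hAss => ?_
  exact ⟨lambdaDipole χ, hall.2 hAss, hall.1 hAss⟩

/-- **Theorem 1 from the TRUE-`λ` one-profile dictionary + the `λ`-box + ell-E13 + E-020 + `hneg`** (the
endgame of Part 5 with the existential `λ` resolved). [cite: Zhang2022LandauSiegel, §1 Theorem 1; §2 p. 6] -/
theorem theorem1_of_ellDictProfileTrue {c' : ℝ} {Fam : (S : Scales) → Finset (Chr S)} {g g' : ℝ → ℂ}
    {G₀ G₁ K A₀ η C₀ Λ A₁ cZ A₂ A : ℝ} (h : EllDictFirstOrderProfileTrue c' Fam g g' G₀ G₁ K A₀)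
    (hbox : EllLambdaBox η C₀) (hΛ : 1 / 2 + η ≤ Λ) (hΛ0 : 0 < Λ) (h23 : Lemma23FixedA c' Fam A₁)
    (hZ : EllZeroModelFixedA Fam cZ A₂) (h0 : A₀ ≤ A) (h1 : A₁ ≤ A) (h2 : A₂ ≤ A)
    (hneg : ∃ D₁ : ℕ, ∀ S : Scales, D₁ ≤ S.D → S.IsEllRegimeP A → ∀ lam : ℝ, |lam| ≤ Λ →
      mainTermFormEll S.ellP (rescale S.shrink g) (rescale' S.shrink g') + (G₀ + lam * G₁) / A
        + K / A ^ 2 < 0) :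
    Theorem1 :=
  theorem1_of_ellDictProfile (ellDictFirstOrderProfile_of_true h hbox hΛ hΛ0) h23 hZ h0 h1 h2 hneg

end TrueLambda

end EllRegime

end Literature.NumberTheory.LFunctions.Zhang2022

end
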